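import Summits.CriticalPhenomena.CardyFormulaZ2.Theorems.CardyQContinuationFirstJetAtOneBounded

/-!
# Uniform jets are necessary for `UniformZeroFree` (crux stmt-CriticalPhenomena-5559)

Notation of the route `CardyQContinuation`: `Z_δ(s) = Σ_{ω ⊆ E(Ω_δ)} s^(|ω| + 2k_B(ω))` is the
self-dual arc partition function of the conformal rectangle `R` at mesh `δ`, `N_δ` its
crossing-restricted part, `P_δ = N_δ/Z_δ` the crossing ratio, `T_ρ` the complex `ρ`-neighbourhood of
`s ∈ [1, √2]`.  The crux `UniformZeroFree` asks for `Z_δ ≠ 0` and `‖P_δ‖ ≤ M` on `T_ρ`, uniformly in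
small `δ`.

The lead's reshaped line (`Cruxes/UniformZeroFree/Lines/birth.lean`, v2) cuts the crux into
`stub_arcZeroFree` (`Z_δ ≠ 0` on `T_ρ`) and `stub_jetsBounded`: there are `M, A ≥ 0` with
`‖P_δ^{(k)}(t)‖ ≤ M · k! · A^k` for all small `δ`, all real `t ∈ [1, √2]` and all `k` — the
all-order, segment-wide form of the route's FirstJet canaries (stmt-5561 / stmt-7102), a statement
about conditional cumulants of `L = |ω| + 2k_B` under the REAL critical FK measures.  The skeleton
proves `stub_arcZeroFree → stub_jetsBounded → UniformZeroFree` (Taylor expansion at real points).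
This file proves the CONVERSE bookkeeping, so that the reshape loses nothing:

* `jetsBounded_of_uniformZeroFree` — `UniformZeroFree → stub_jetsBounded` (Cauchy's estimates
  `‖P_δ^{(k)}(t)‖ ≤ k! · M / (ρ/2)^k` on the discs `|s − t| ≤ ρ/2 ⊂ T_ρ`,
  `Complex.norm_iteratedDeriv_le_of_forall_mem_sphere_norm_le`), i.e. given arc zero-freeness the
  jet stub is EQUIVALENT to the crux; in particular every divergent real jet of `P_δ` (any order, any
  point of the segment) refutes the crux — the kill criterion behind stmt-5561/7102, made uniform.
-/

namespace Summit.CriticalPhenomena.CardyFormulaZ2.Theorems.UniformZeroFree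

open Filter Metric Set
open scoped Topology Nat
open Literature.Probability.LatticeModels Literature.Probability.Percolation
open Literature.Probability.RandomPlanarGeometry
open Summit.CriticalPhenomena.CardyFormulaZ2.Theorems.CardyQContinuation
open Summit.CriticalPhenomena.CardyFormulaZ2.Theses.CardyQContinuation

/-- **Cauchy's estimates, all orders, ball form.** If `P` is complex differentiable on the open disc
`ball c ρ` and bounded there by `M`, then `‖P^{(k)}(c)‖ ≤ M · k! · (2/ρ)^k` for every `k`
(`Complex.norm_iteratedDeriv_le_of_forall_mem_sphere_norm_le` on the circle of radius `ρ/2`).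
[folklore] -/
theorem norm_iteratedDeriv_le_of_forall_mem_ball {P : ℂ → ℂ} {c : ℂ} {ρ M : ℝ} (hρ : 0 < ρ)
    (hd : DifferentiableOn ℂ P (ball c ρ)) (hb : ∀ s ∈ ball c ρ, ‖P s‖ ≤ M) (k : ℕ) :
    ‖iteratedDeriv k P c‖ ≤ M * (k.factorial : ℝ) * (2 / ρ) ^ k := by
  have hρ2 : 0 < ρ / 2 := by positivity
  have hsub : closedBall c (ρ / 2) ⊆ ball c ρ := closedBall_subset_ball (by linarith)
  have h := Complex.norm_iteratedDeriv_le_of_forall_mem_sphere_norm_le k hρ2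
    (hd.diffContOnCl_ball hsub) fun z hz => hb z (hsub (sphere_subset_closedBall hz))
  calc ‖iteratedDeriv k P c‖ ≤ (k.factorial : ℝ) * M / (ρ / 2) ^ k := h
    _ = M * (k.factorial : ℝ) * (2 / ρ) ^ k := by
      rw [div_pow, div_pow]
      field_simp

/-- The crossing ratio `N/Z = (Σ_S 𝟙_C s^{m a}) / (Σ_S s^{m a})` (finite `S`) is holomorphic on any
set where the denominator does not vanish. [folklore] -/
theorem differentiableOn_ratio {α : Type*} {S : Set α} (hS : S.Finite) (C : Set α) (m : α → ℕ)
    {U : Set ℂ} (hZ : ∀ z ∈ U, (∑ᶠ a ∈ S, z ^ m a) ≠ 0) :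
    DifferentiableOn ℂ
      (fun z : ℂ => (∑ᶠ a ∈ S, C.indicator (fun b => z ^ m b) a) / ∑ᶠ a ∈ S, z ^ m a) U := by
  intro z hz
  have hN : Differentiable ℂ (fun z : ℂ => ∑ᶠ a ∈ S, C.indicator (fun b => z ^ m b) a) :=
    differentiable_finsum_mem hS fun a => differentiable_indicator_pow C m a
  have hD : Differentiable ℂ (fun z : ℂ => ∑ᶠ a ∈ S, z ^ m a) :=
    differentiable_finsum_mem hS fun a => differentiable_pow (m a)
  exact ((hN z).div (hD z) (hZ z hz)).differentiableWithinAt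

/-- **`UniformZeroFree → stub_jetsBounded`**: if `Z_δ ≠ 0` and `‖N_δ/Z_δ‖ ≤ M` on `T_ρ` for all small
`δ`, then for all small `δ`, every real `t ∈ [1, √2]` and every `k`,
`‖(N_δ/Z_δ)^{(k)}(t)‖ ≤ M · k! · (2/ρ)^k` — the disc `|s − t| < ρ` lies in `T_ρ`, on which `N_δ/Z_δ` is
a quotient of polynomials with non-vanishing denominator (for `δ > 0` the configuration space is
finite, `finite_powerset_edgeSet`), and Cauchy's estimates apply.  Stated with the SAME `let`
bindings as the crux and as the registered stub `stub_jetsBounded` of the line `birth` (v2), whose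
converse `stub_arcZeroFree → stub_jetsBounded → UniformZeroFree` is the line's glue. [folklore] -/
theorem jetsBounded_of_uniformZeroFree : Summit.CriticalPhenomena.CardyFormulaZ2.Theses.CardyQContinuation.UniformZeroFree → (let w : Literature.Probability.RandomPlanarGeometry.ConformalRectangle → ℝ → ℂ → Set (Sym2 (Literature.Probability.LatticeModels.Site 2)) → ℂ := fun R δ s ω ↦ s ^ (ω.ncard + 2 * Nat.card ((Literature.Probability.Percolation.openGraph ω ⊔ Literature.Probability.LatticeModels.wired (Literature.Probability.LatticeModels.discreteArc R.carrier δ (R.arc 0) ∪ Literature.Probability.LatticeModels.discreteArc R.carrier δ (R.arc 2))).induce (Literature.Probability.LatticeModels.meshDomain R.carrier δ)).ConnectedComponent); let Z : Literature.Probability.RandomPlanarGeometry.ConformalRectangle → ℝ → ℂ → ℂ := fun R δ s ↦ ∑ᶠ ω ∈ 𝒫 (Literature.Probability.LatticeModels.discreteDomainGraph R.carrier δ).edgeSet, w R δ s ω; let N : Literature.Probability.RandomPlanarGeometry.ConformalRectangle → ℝ → ℂ → ℂ := fun R δ s ↦ ∑ᶠ ω ∈ 𝒫 (Literature.Probability.LatticeModels.discreteDomainGraph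 R.carrier δ).edgeSet, (Literature.Probability.Percolation.discreteCrossing R.carrier δ (R.arc 0) (R.arc 2)).indicator (w R δ s) ω; ∀ R : Literature.Probability.RandomPlanarGeometry.ConformalRectangle, ∃ M A : ℝ, 0 ≤ A ∧ ∀ᶠ δ in nhdsWithin (0:ℝ) (Set.Ioi 0), ∀ t ∈ Set.Icc (1:ℝ) (Real.sqrt 2), ∀ k : ℕ, ‖iteratedDeriv k (fun s ↦ N R δ s / Z R δ s) (t : ℂ)‖ ≤ M * (k.factorial : ℝ) * A ^ k) := by
  intro hU
  have hU' := hU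
  dsimp only [Summit.CriticalPhenomena.CardyFormulaZ2.Theses.CardyQContinuation.UniformZeroFree] at hU'
  dsimp only
  intro R
  obtain ⟨ρ, hρ, M, hev⟩ := hU' R
  refine ⟨M, 2 / ρ, by positivity, ?_⟩
  have hpos : ∀ᶠ δ in 𝓝[>] (0 : ℝ), 0 < δ := self_mem_nhdsWithin
  filter_upwards [hev, hpos] with δ hδ hδpos
  intro t ht k
  -- the disc `|s - t| < ρ` lies in the thickened segment
  have hball : ∀ s ∈ ball (t : ℂ) ρ,
      s ∈ Metric.thickening ρ (((↑) : ℝ → ℂ) '' Set.Icc (1 : ℝ) (Real.sqrt 2)) := by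
    intro s hs
    rw [Metric.mem_thickening_iff]
    exact ⟨(t : ℂ), ⟨t, ht, rfl⟩, hs⟩
  have hfin := finite_powerset_edgeSet R.isBounded hδpos
  have hdiff := differentiableOn_ratio hfin
    (Literature.Probability.Percolation.discreteCrossing R.carrier δ (R.arc 0) (R.arc 2))
    (fun ω ↦ ω.ncard + 2 * Nat.card ((Literature.Probability.Percolation.openGraph ω ⊔
      Literature.Probability.LatticeModels.wired
        (Literature.Probability.LatticeModels.discreteArc R.carrier δ (R.arc 0) ∪
          Literature.Probability.LatticeModels.discreteArc R.carrier δ (R.arc 2))).induce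
      (Literature.Probability.LatticeModels.meshDomain R.carrier δ)).ConnectedComponent)
    (U := ball (t : ℂ) ρ) fun z hz => (hδ z (hball z hz)).1
  exact norm_iteratedDeriv_le_of_forall_mem_ball hρ hdiff (fun s hs => (hδ s (hball s hs)).2) k

end Summit.CriticalPhenomena.CardyFormulaZ2.Theorems.UniformZeroFree
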